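import Summits.ResolutionOfSingularities.ResolutionOfSingularities.Theorems.WeightedInvariantWeightedThesisFunctionFieldKaehler
import Summits.ResolutionOfSingularities.ResolutionOfSingularities.Theorems.WeightedInvariantWeightedThesisFormFnGenerates
import Literature.AlgebraicGeometry.Resolution.LinearSectionsChoice
import Literature.AlgebraicGeometry.Motives.ProjectiveNoetherNormalization

/-!
# `WeightedInvariant.WeightedThesis`, line `datum-glued-split`, stub A (unconditional), I:
# forms of high degree with independent differentials

First of two files for the registered stub `stub_separableProjection` (crux `WeightedThesis`,
stmt-ResolutionOfSingularities-0569): separable projective Noether normalisation over a PERFECT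
(possibly finite) field, by forms of high degree instead of generic linear forms. All PROVED. For an
integral closed `ι : X ↪ ℙⁿ_k` let `φ : k[x₀, …, xₙ] → K(X)`, `G ↦ G(x/x_{j₀})`, be the
dehomogenisation at a chart `j₀` through the generic point (`ProjFrac.dehomFn`):

* `isSeparable_of_linearIndependent` — field theory: if `d = dim_K Ω[K⁄k]` elements of the image of
  `L → K` have independent differentials then `K / L` is finite separable (`Ω[K⁄L] = 0`, Mathlib
  `Algebra.FormallyUnramified.iff_isSeparable`);
* `lsChart_eq_ZH` — for forms `H₀, …, H_d` of a common degree without common zero on `X`, the charts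
  of the linear system of `(φ(H_i))ᵢ` (`Resolution.lsChart`) are the affine opens `X_{H_i}`;
* `exists_D_X_notMem` — the `dφ(x_l)` span `Ω[K(X)⁄k]` (`FormFnGenerates.adjoin_formFn_div_eq_top`);
* `exists_form_step`, `exists_forms` — **the sequential choice**: forms `g₁, …, g_d` of degrees
  PRIME TO `p` such that (a) `g_i` misses the generic points of the irreducible components of
  `X ∩ V(x_{j₀}, g₁, …, g_{i-1})` (homogeneous prime avoidance in all large degrees,
  `MvPolynomial.exists_forall_le_isHomogeneous_forall_notMem`; the dimension then drops,
  `topologicalKrullDim_lt_of_forall_exists_specializes`) and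
  (b) `dφ(g_i) ∉ ⟨dφ(g₁), …, dφ(g_{i-1})⟩`: a form `F` with (a) but not (b) is replaced by
  `F + x_{j₀}^{e-1} x_l` with `dφ(x_l)` outside the span, which still avoids the primes since they
  contain `x_{j₀}`.

## References

* D. Eisenbud, *Commutative Algebra with a View Toward Algebraic Geometry* (1995), Cor. 16.18
  (separable Noether normalisation over a perfect field). [Eisenbud1995]
* R. Hartshorne, *Algebraic Geometry* (1977), II Thm. 8.6A (differentials and separating
  transcendence bases). [Hartshorne1977]
-/

noncomputable section

set_option linter.dupNamespace false -- mandated namespace of this single-conjunct summit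

open CategoryTheory AlgebraicGeometry TopologicalSpace Topology Opposite HomogeneousLocalization
open Literature.AlgebraicGeometry.Morphisms.ProjCech (grading PP)
open Literature.AlgebraicGeometry.Motives Literature.AlgebraicGeometry.Motives.ProjFrac
open Literature.AlgebraicGeometry.Motives.RatFn Literature.AlgebraicGeometry.Resolution
open Literature.Topology
open Literature.AlgebraicGeometry.Resolution.LinSec (j₀ genericPoint_mem_chart_j₀)

namespace Summit.ResolutionOfSingularities.ResolutionOfSingularities.Theorems.WeightedThesis.HypersurfaceModel

namespace SeparableProjection

universe u

/-! ## Field theory: elements with independent differentials coming from a subfield -/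

/-- **If `d = dim_K Ω[K⁄k]` elements of the image of `L → K` have `K`-linearly independent
differentials then `K / L` is finite separable** (`K / k` essentially of finite type): their
differentials span `Ω[K⁄k]` and die in `Ω[K⁄L]`, a quotient of `Ω[K⁄k]`, so `Ω[K⁄L] = 0` and
`K / L` is formally unramified and essentially of finite type (Mathlib
`Algebra.FormallyUnramified.isSeparable`, `finite_of_free`). [folklore] -/
theorem isSeparable_of_linearIndependent {k L K : Type*} [Field k] [Field L] [Field K]
    [Algebra k L] [Algebra k K] [Algebra L K] [IsScalarTower k L K] [Algebra.EssFiniteType k K]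
    [Module.Finite K (Ω[K⁄k])] {d : ℕ} (hd : Module.finrank K (Ω[K⁄k]) = d) (u : Fin d → K)
    (hu : ∀ j, u j ∈ Set.range (algebraMap L K))
    (hli : LinearIndependent K fun j => KaehlerDifferential.D k K (u j)) :
    Algebra.IsSeparable L K ∧ Module.Finite L K := by
  -- adapted from `FieldCore.isSeparable_of_span_D_eq_top` (intermediate field ↦ any subfield)
  have hspan : Submodule.span K (Set.range fun j => KaehlerDifferential.D k K (u j)) = ⊤ :=
    hli.span_eq_top_of_card_eq_finrank' (by rw [hd, Fintype.card_fin])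
  have hzero : KaehlerDifferential.map k L K K = 0 := by
    rw [← LinearMap.ker_eq_top, eq_top_iff, ← hspan, Submodule.span_le]
    rintro _ ⟨j, rfl⟩
    obtain ⟨ℓ, hℓ⟩ := hu j
    rw [SetLike.mem_coe, LinearMap.mem_ker, KaehlerDifferential.map_D, ← hℓ]
    exact Derivation.map_algebraMap (KaehlerDifferential.D L K) ℓ
  have hsub : Subsingleton (Ω[K⁄L]) := ⟨fun a b => by
    obtain ⟨a, rfl⟩ := KaehlerDifferential.map_surjective k L K a
    obtain ⟨b, rfl⟩ := KaehlerDifferential.map_surjective k L K b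
    rw [hzero]; rfl⟩
  haveI : Algebra.FormallyUnramified L K := ⟨hsub⟩
  haveI : Algebra.EssFiniteType L K := Algebra.EssFiniteType.of_comp k L K
  haveI := Algebra.FormallyUnramified.finite_of_free (R := L) (S := K)
  exact ⟨Algebra.FormallyUnramified.isSeparable L K, inferInstance⟩

/-! ## The rational functions `φ(G) = G(x/x_{j₀})` of forms on `X ⊆ ℙⁿ` -/

variable {k : Type u} [Field k] {n : ℕ} {X : Scheme.{u}} [IsIntegral X] (ι : X ⟶ PP k n)

/-- `φ(x_{j₀}) = 1` for the dehomogenisation `φ = dehomFn ι j₀` at a coordinate `x_{j₀}` with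
`X ⊄ V(x_{j₀})`. [folklore] -/
theorem dehomFn_X_self (j₀ : Fin (n + 1)) (hj₀ : genericPoint X ∈ LinSec.chart ι j₀) :
    dehomFn ι j₀ hj₀ (MvPolynomial.X j₀) = 1 := by
  have h0 := dehomFn_ne_zero ι hj₀ (LinSec.X_mem j₀) one_pos hj₀
  have key := fracFn_mk_mul_dehomFn_pow ι hj₀ (LinSec.X_mem j₀) hj₀ 1 (G := MvPolynomial.X j₀)
    (by simpa using LinSec.X_mem (k := k) j₀)
  rw [pow_one] at key
  rw [dehomFn_of_mem ι j₀ hj₀ (LinSec.X_mem j₀)] at key h0 ⊢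
  exact (mul_eq_right₀ h0).1 key

section Charts

variable (j₀ : Fin (n + 1)) (hj₀ : genericPoint X ∈ LinSec.chart ι j₀) {M d : ℕ} (hM : 0 < M)
  {H : Fin (d + 1) → MvPolynomial (Fin (n + 1)) k} (hH : ∀ i, H i ∈ grading k n M)

include hM hH

/-- For forms `H₀, …, H_d` of a common degree `M > 0`, a point of `X_{H_i}` lies in the `i`-th
chart of the linear system of `(φ(H₀), …, φ(H_d))`: `φ(H_l)/φ(H_i)` is the rational function of
the fraction `H_l/H_i`, regular on `X_{H_i}`. [folklore] -/
theorem mem_lsChart_of_mem_ZH {x : X} {i : Fin (d + 1)} (hx : x ∈ ZH ι (H i)) :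
    x ∈ lsChart (fun l => dehomFn ι j₀ hj₀ (H l)) i := by
  have hne : genericPoint X ∈ ZH ι (H i) := genericPoint_mem_of_mem hx
  refine (mem_lsChart_iff _).2 ⟨dehomFn_ne_zero ι hj₀ (hH i) hM hne, fun l => ?_⟩
  have e := fracFn_mk_eq_div ι hj₀ (hH i) hM hne 1 (G := H l) (by simpa using hH l)
  rw [pow_one] at e
  rw [← e]
  exact isRegularAt_fracFn ι (H i) hx _

/-- **The charts of the linear system of `(φ(H_i))ᵢ` are the opens `X_{H_i}`** when the `H_i` have
no common zero on `X`: on the `i`-th chart, at a point of `X_{H_{i'}}`, `φ(H_i)/φ(H_{i'})` is a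
unit, and the unit locus of (the `M`-th power of) this fraction in `X_{H_{i'}}` is `X_{H_{i'} H_i}`
(`ProjFrac.ZH_mul_eq_basicOpen_evalAway`). [folklore] -/
theorem lsChart_eq_ZH (hcov : ∀ x : X, ∃ i, x ∈ ZH ι (H i)) (i : Fin (d + 1)) :
    lsChart (fun l => dehomFn ι j₀ hj₀ (H l)) i = ZH ι (H i) := by
  letI := MvPolynomial.gradedAlgebra (σ := Fin (n + 1)) (R := k)
  ext x
  refine ⟨fun hxi => ?_, mem_lsChart_of_mem_ZH ι j₀ hj₀ hM hH⟩
  obtain ⟨i', hi'⟩ := hcov x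
  set z : Fin (d + 1) → X.functionField := fun l => dehomFn ι j₀ hj₀ (H l) with hz
  have hxi' : x ∈ lsChart z i' := mem_lsChart_of_mem_ZH ι j₀ hj₀ hM hH hi'
  have h0 : z i ≠ 0 := ne_zero_of_mem_lsChart z hxi
  have h0' : z i' ≠ 0 := ne_zero_of_mem_lsChart z hxi'
  have hu : IsUnitAt x (z i / z i') := isUnitAt_iff.2 ⟨div_ne_zero h0 h0',
    isRegularAt_of_mem_lsChart z hxi' i, by rw [inv_div]; exact isRegularAt_of_mem_lsChart z hxi i'⟩
  have hne' : genericPoint X ∈ ZH ι (H i') := genericPoint_mem_of_mem hi'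
  have e :=
    fracFn_mk_eq_div ι hj₀ (hH i') hM hne' M (G := H i ^ M) (SetLike.pow_mem_graded M (hH i))
  have hu' : IsUnitAt x (fracFn ι (H i') hne' (Away.isLocalizationElem (hH i') (hH i))) := by
    rw [Away.isLocalizationElem, e, map_pow, ← div_pow]
    exact hu.pow M
  rw [fracFn_apply, isUnitAt_ofSection_iff hi',
    ← ZH_mul_eq_basicOpen_evalAway ι (hH i') hM (hH i) hM, ZH_mul] at hu'
  exact hu'.2

end Charts

/-! ## The sequential choice of the forms -/

/-- The base loci `Z = X ∩ V(x_{j₀}, g₁, …, g_i)` are closed. [folklore] -/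
theorem isClosed_base {i : ℕ} (g : Fin i → MvPolynomial (Fin (n + 1)) k) :
    IsClosed {x : X | x ∉ LinSec.chart ι (LinSec.j₀ ι) ∧ ∀ j, x ∉ ZH ι (g j)} := by
  have : {x : X | x ∉ LinSec.chart ι (LinSec.j₀ ι) ∧ ∀ j, x ∉ ZH ι (g j)} =
      ((LinSec.chart ι (LinSec.j₀ ι) : Set X)ᶜ) ∩ ⋂ j, ((ZH ι (g j) : X.Opens) : Set X)ᶜ := by
    ext x; simp
  rw [this]
  exact (LinSec.chart ι (LinSec.j₀ ι)).2.isClosed_compl.inter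
    (isClosed_iInter fun j => (ZH ι (g j)).2.isClosed_compl)

section Forms

variable [Algebra k X.functionField]
  (halg : algebraMap k X.functionField = (X.presheaf.germ ⊤ (genericPoint X) trivial).hom.comp
    ((ι ≫ Literature.AlgebraicGeometry.Morphisms.ProjCech.toSpec k n).appTop.hom.comp
      (Scheme.ΓSpecIso (.of k)).inv.hom))

include halg

/-- **The differentials `dφ(x_l)` of the affine coordinates span `Ω[K(X)⁄k]`**: a proper subspace
misses one of them (the ratios of linear forms generate `K(X)` over `k`,
`FormFnGenerates.adjoin_formFn_div_eq_top`, and `φ(x_{j₀}) = 1`). [folklore] -/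
theorem exists_D_X_notMem [IsClosedImmersion ι]
    (S : Submodule X.functionField (Ω[X.functionField⁄k])) (hS : S ≠ ⊤) :
    ∃ l : Fin (n + 1),
      KaehlerDifferential.D k X.functionField
        (dehomFn ι (j₀ ι) (genericPoint_mem_chart_j₀ ι) (MvPolynomial.X l)) ∉ S := by
  by_contra hall
  push Not at hall
  apply hS
  rw [eq_top_iff, ← KaehlerDifferential.span_range_derivation, Submodule.span_le]
  rintro _ ⟨x, rfl⟩
  have h1 : LinSec.formFn ι (Pi.single (LinSec.j₀ ι) 1) = 1 := by
    rw [LinSec.formFn, LinSec.linForm_single]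
    exact dehomFn_X_self ι _ _
  have hx : x ∈ IntermediateField.adjoin k (Set.range fun c : Fin (n + 1) → k =>
      LinSec.formFn ι c / LinSec.formFn ι (Pi.single (LinSec.j₀ ι) 1)) := by
    rw [FormFnGenerates.adjoin_formFn_div_eq_top ι halg _ (by rw [h1]; exact one_ne_zero)]
    trivial
  refine (Submodule.span_le.2 ?_) (FieldCore.D_mem_span_of_mem_adjoin hx)
  rintro _ ⟨_, ⟨c, rfl⟩, rfl⟩
  dsimp only
  rw [SetLike.mem_coe, h1, div_one, LinSec.formFn, LinSec.linForm, map_sum, map_sum]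
  refine S.sum_mem fun l _ => ?_
  rw [map_mul, FormFnGenerates.dehomFn_C ι halg, Derivation.leibniz, Derivation.map_algebraMap,
    smul_zero, add_zero]
  exact S.smul_mem _ (hall l)

variable [NoetherianSpace X]

/-- **One step of the sequential choice.** For a closed `Z ⊆ X ∩ V(x_{j₀})`, a proper subspace
`S ⊊ Ω[K(X)⁄k]` and `p ≥ 2` there is a form `G` of a positive degree `e` prime to `p` such that
`dφ(G) ∉ S` and every point of `Z` is a specialisation of a point of `Z ∩ X_G`: homogeneous prime
avoidance in all large degrees (`MvPolynomial.exists_forall_le_isHomogeneous_forall_notMem`) for the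
primes of the generic points of the irreducible components of `Z` gives `F` of degree
`e = p (e₀ + 1) + 1`, and `G = F + c x_{j₀}^{e-1} x_l` (`c ∈ {0, 1}`, `dφ(x_l) ∉ S`) still avoids
these primes, which contain `x_{j₀}`. [folklore] -/
theorem exists_form_step [IsClosedImmersion ι] {p : ℕ} (hp : 1 < p) (Z : Set X) (hZc : IsClosed Z)
    (hZ : ∀ z ∈ Z, z ∉ LinSec.chart ι (LinSec.j₀ ι))
    (S : Submodule X.functionField (Ω[X.functionField⁄k])) (hS : S ≠ ⊤) :
    ∃ (e : ℕ) (G : MvPolynomial (Fin (n + 1)) k), 0 < e ∧ ¬ p ∣ e ∧ G ∈ grading k n e ∧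
      KaehlerDifferential.D k X.functionField 
        (dehomFn ι (j₀ ι) (genericPoint_mem_chart_j₀ ι) G) ∉ S ∧
      ∀ z ∈ Z, ∃ w ∈ Z, w ⤳ z ∧ w ∈ ZH ι G := by
  classical
  letI := MvPolynomial.gradedAlgebra (σ := Fin (n + 1)) (R := k)
  -- the primes of the component generic points of `Z` (`LinSec.genPts`); all contain `x_{j₀}`
  let T : Finset (Ideal (MvPolynomial (Fin (n + 1)) k)) :=
    (LinSec.genPts_finite Z).toFinset.image fun w => (ι w).asHomogeneousIdeal.toIdeal
  have hTX : ∀ P ∈ T, (MvPolynomial.X (LinSec.j₀ ι) : MvPolynomial (Fin (n + 1)) k) ∈ P := by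
    intro P hP
    obtain ⟨w, hw, rfl⟩ := Finset.mem_image.1 hP
    by_contra h
    exact hZ _ (LinSec.genPts_subset Z ((Set.Finite.mem_toFinset _).1 hw)) h
  obtain ⟨e₀, he₀⟩ :=
    Literature.RingTheory.GradedAlgebra.MvPolynomial.exists_forall_le_isHomogeneous_forall_notMem T
      (fun P hP => by
        obtain ⟨w, -, rfl⟩ := Finset.mem_image.1 hP
        infer_instance)
      (fun P hP => by
        obtain ⟨w, -, rfl⟩ := Finset.mem_image.1 hP
        exact HomogeneousIdeal.isHomogeneous _)
      (fun P hP => by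
        obtain ⟨w, -, rfl⟩ := Finset.mem_image.1 hP
        intro hle
        exact (ι w).not_irrelevant_le fun x hx => hle hx)
  -- the degree `e = p (e₀ + 1) + 1`
  obtain ⟨m, hm⟩ : ∃ m, m = p * (e₀ + 1) := ⟨_, rfl⟩
  have hm1 : e₀ + 1 < m := by
    rw [hm]; exact lt_mul_left (Nat.succ_pos _) hp
  have hpe : ¬ p ∣ m + 1 := by
    rw [hm, Nat.dvd_add_right (dvd_mul_right p _)]
    exact fun h => absurd hp (not_lt.2 (Nat.le_of_dvd one_pos h))
  obtain ⟨F, hFhom, hFT⟩ := he₀ (m + 1) (by omega)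
  obtain ⟨l, hl⟩ := exists_D_X_notMem ι halg S hS
  -- the candidates `F + c • x_{j₀}^m x_l`
  let G : k → MvPolynomial (Fin (n + 1)) k := fun c =>
    F + MvPolynomial.C c * MvPolynomial.X (LinSec.j₀ ι) ^ m * MvPolynomial.X l
  have hGhom : ∀ c, G c ∈ grading k n (m + 1) := fun c => by
    refine Submodule.add_mem _ hFhom ?_
    have := ((MvPolynomial.isHomogeneous_C _ c).mul ((MvPolynomial.isHomogeneous_X k
      (LinSec.j₀ ι)).pow m)).mul (MvPolynomial.isHomogeneous_X k l)
    simpa using this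
  have hGT : ∀ c, ∀ P ∈ T, G c ∉ P := fun c P hP hGP => by
    haveI : P.IsPrime := by
      obtain ⟨w, -, rfl⟩ := Finset.mem_image.1 hP
      infer_instance
    refine hFT P hP ?_
    have h2 : MvPolynomial.C c * MvPolynomial.X (LinSec.j₀ ι) ^ m * MvPolynomial.X l ∈ P :=
      P.mul_mem_right _ (P.mul_mem_left _ (P.pow_mem_of_mem (hTX P hP) m (by omega)))
    simpa [G] using P.sub_mem hGP h2
  have hGgen : ∀ c, ∀ z ∈ Z, ∃ w ∈ Z, w ⤳ z ∧ w ∈ ZH ι (G c) := fun c z hz => by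
    obtain ⟨w, hw, hwz⟩ := LinSec.exists_genPts_specializes hZc hz
    exact ⟨w, LinSec.genPts_subset Z hw, hwz,
      hGT c _ (Finset.mem_image_of_mem _ ((Set.Finite.mem_toFinset _).2 hw))⟩
  have hφG : ∀ c, dehomFn ι (j₀ ι) (genericPoint_mem_chart_j₀ ι) (G c) =
      dehomFn ι (j₀ ι) (genericPoint_mem_chart_j₀ ι) F +
        algebraMap k X.functionField c *
          dehomFn ι (j₀ ι) (genericPoint_mem_chart_j₀ ι) (MvPolynomial.X l) := by
    intro c
    simp only [G, map_add, map_mul, map_pow, dehomFn_X_self, one_pow, mul_one,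
      FormFnGenerates.dehomFn_C ι halg]
  have hDG : ∀ c,
      KaehlerDifferential.D k X.functionField
          (dehomFn ι (j₀ ι) (genericPoint_mem_chart_j₀ ι) (G c)) =
      KaehlerDifferential.D k X.functionField (dehomFn ι (j₀ ι) (genericPoint_mem_chart_j₀ ι) F) +
        c • KaehlerDifferential.D k X.functionField
          (dehomFn ι (j₀ ι) (genericPoint_mem_chart_j₀ ι) (MvPolynomial.X l)) := fun c => by
    rw [hφG, map_add, Derivation.leibniz, Derivation.map_algebraMap, smul_zero, add_zero,
      algebraMap_smul]
  by_cases hFS :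
    KaehlerDifferential.D k X.functionField (dehomFn ι (j₀ ι) (genericPoint_mem_chart_j₀ ι) F) ∈ S
  · refine ⟨m + 1, G 1, Nat.succ_pos _, hpe, hGhom 1, fun h => hl ?_, hGgen 1⟩
    have := S.sub_mem h hFS
    rwa [hDG, one_smul, add_sub_cancel_left] at this
  · refine ⟨m + 1, G 0, Nat.succ_pos _, hpe, hGhom 0, ?_, hGgen 0⟩
    rwa [hDG, zero_smul, add_zero]

/-- **The sequential choice.** If `dim X = d = dim Ω[K(X)⁄k]`, then for every `i ≤ d` there are
forms `g₁, …, g_i` of positive degrees prime to `p` with `dφ(g₁), …, dφ(g_i)` linearly independent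
and `dim X ∩ V(x_{j₀}, g₁, …, g_i) < d - i` (`exists_form_step` and the dimension drop
`topologicalKrullDim_lt_of_forall_exists_specializes`). [folklore] -/
theorem exists_forms [IsClosedImmersion ι] {p : ℕ} (hp : 1 < p) {d : ℕ}
    [Module.Finite X.functionField (Ω[X.functionField⁄k])]
    (hrank : Module.finrank X.functionField (Ω[X.functionField⁄k]) = d)
    (hdim : topologicalKrullDim X = d) :
    ∀ i, i ≤ d → ∃ (N : Fin i → ℕ) (g : Fin i → MvPolynomial (Fin (n + 1)) k),
      (∀ j, 0 < N j ∧ ¬ p ∣ N j ∧ g j ∈ grading k n (N j)) ∧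
      LinearIndependent X.functionField
          (fun j => KaehlerDifferential.D k X.functionField
            (dehomFn ι (j₀ ι) (genericPoint_mem_chart_j₀ ι) (g j))) ∧
      topologicalKrullDim {x : X | x ∉ LinSec.chart ι (LinSec.j₀ ι) ∧ ∀ j, x ∉ ZH ι (g j)} <
        (d - i : ℕ) := by
  intro i
  induction i with
  | zero =>
    intro _
    refine ⟨Fin.elim0, Fin.elim0, fun j => j.elim0, linearIndependent_empty_type, ?_⟩
    rw [Nat.sub_zero]
    refine topologicalKrullDim_lt_of_isClosed_ssubset (isClosed_base ι Fin.elim0) ?_ d ?_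
    · intro h
      rw [Set.eq_univ_iff_forall] at h
      exact (h (genericPoint X)).1 (LinSec.genericPoint_mem_chart_j₀ ι)
    · rw [hdim]; exact_mod_cast Nat.lt_succ_self d
  | succ i ih =>
    intro hi
    obtain ⟨N, g, hNg, hli, hZ⟩ := ih (Nat.le_of_succ_le hi)
    set Z : Set X := {x : X | x ∉ LinSec.chart ι (LinSec.j₀ ι) ∧ ∀ j, x ∉ ZH ι (g j)} with hZdef
    set S : Submodule X.functionField (Ω[X.functionField⁄k]) :=
      Submodule.span X.functionField (Set.range fun j => KaehlerDifferential.D k X.functionField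
        (dehomFn ι (j₀ ι) (genericPoint_mem_chart_j₀ ι) (g j))) with hSdef
    have hS : S ≠ ⊤ := fun h => by
      have h1 : Module.finrank X.functionField S ≤ i :=
        (finrank_range_le_card _).trans (Fintype.card_fin i).le
      rw [h, finrank_top, hrank] at h1
      omega
    obtain ⟨e, G, he, hpe, hG, hGS, hgen⟩ :=
      exists_form_step ι halg hp Z (isClosed_base ι g) (fun z hz => hz.1) S hS
    let N' : Fin (i + 1) → ℕ := Fin.snoc N e
    let g' : Fin (i + 1) → MvPolynomial (Fin (n + 1)) k := Fin.snoc g G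
    have hg'c : ∀ j : Fin i, g' j.castSucc = g j := fun j => by simp [g']
    have hg'l : g' (Fin.last i) = G := by simp [g']
    have hN'c : ∀ j : Fin i, N' j.castSucc = N j := fun j => by simp [N']
    have hN'l : N' (Fin.last i) = e := by simp [N']
    refine ⟨N', g', ?_, ?_, ?_⟩
    · intro j
      refine Fin.lastCases ?_ (fun j => ?_) j
      · rw [hg'l, hN'l]; exact ⟨he, hpe, hG⟩
      · rw [hg'c, hN'c]; exact hNg j
    · have : (fun j => KaehlerDifferential.D k X.functionField
            (dehomFn ι (j₀ ι) (genericPoint_mem_chart_j₀ ι) (g' j))) =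
          Fin.snoc (fun j => KaehlerDifferential.D k X.functionField
              (dehomFn ι (j₀ ι) (genericPoint_mem_chart_j₀ ι) (g j)))
            (KaehlerDifferential.D k X.functionField
              (dehomFn ι (j₀ ι) (genericPoint_mem_chart_j₀ ι) G)) := by
        funext j
        refine Fin.lastCases ?_ (fun j => ?_) j
        · rw [hg'l, Fin.snoc_last]
        · rw [hg'c, Fin.snoc_castSucc]
      rw [this]
      exact hli.finSnoc hGS
    · have hZ' : {x : X | x ∉ LinSec.chart ι (LinSec.j₀ ι) ∧ ∀ j, x ∉ ZH ι (g' j)} =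
          {x | x ∈ Z ∧ x ∉ ZH ι G} := by
        ext x
        simp only [Set.mem_setOf_eq, Fin.forall_fin_succ', hg'c, hg'l, hZdef, and_assoc]
      rw [hZ']
      have hZ'c : IsClosed {x | x ∈ Z ∧ x ∉ ZH ι G} := by
        rw [← hZ']; exact isClosed_base ι _
      have e1 : d - (i + 1) + 1 = d - i := by omega
      refine topologicalKrullDim_lt_of_forall_exists_specializes (isClosed_base ι g) hZ'c
        (fun x hx => hx.1) (fun z hz => ?_) (d - (i + 1)) (by rw [e1]; exact hZ)
      obtain ⟨w, hwZ, hwz, hwG⟩ := hgen z hz.1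
      exact ⟨w, hwZ, fun h => h.2 hwG, hwz⟩

end Forms

end SeparableProjection

/-- **Registered shape (universe `0`) of the field-theoretic criterion of file I** (sub-goal
`stub_isSeparable_of_linearIndependent` of `stub_separableProjection`): if `d = dim_K Ω[K⁄k]`
elements of the image of `L → K` have independent differentials (`K / k` essentially of finite
type, `k → L → K` a tower) then `K / L` is finite separable
(`SeparableProjection.isSeparable_of_linearIndependent`). [folklore] -/
theorem stub_isSeparable_of_linearIndependent : ∀ (k L K : Type) [Field k] [Field L] [Field K] [Algebra k L] [Algebra k K] [Algebra L K] [IsScalarTower k L K] [Algebra.EssFiniteType k K] [Module.Finite K (Ω[K⁄k])] (d : ℕ), Module.finrank K (Ω[K⁄k]) = d → ∀ (u : Fin d → K), (∀ j, u j ∈ Set.range (algebraMap L K)) → LinearIndependent K (fun j => KaehlerDifferential.D k K (u j)) → Algebra.IsSeparable L K ∧ Module.Finite L K :=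
  fun _ _ _ _ _ _ _ _ _ _ _ _ _ hd u hu hli =>
    SeparableProjection.isSeparable_of_linearIndependent hd u hu hli

end Summit.ResolutionOfSingularities.ResolutionOfSingularities.Theorems.WeightedThesis.HypersurfaceModel

end
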